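import Summits.ABC.IUTFork.Cor312PilotIdelesPrArch
import Summits.ABC.IUTFork.Cor312PilotIdelesPrThetaSide
import Summits.ABC.IUTFork.Repair.CandDupuyHilado31
import HarnessLib

/-!
# [IUTchIII] Corollary 3.12 at the FOURTH CORNER (print-normalised weights, honest archimedean place, pilot regions from ideles):
# the Θ-SIDE NUMBERS with the archimedean terms — every Kummer-image family has procession volume
# `−deĝ_lgp(P_Θ) + 𝔼_j (j+1)·log π`, hence `≤ −|log(Θ)|`, and TEAM B's input is an EXPLICIT numerical inequality

PROOF-ONLY record file (D-0012; no definitions) of the abc-iut cell (Cor. 3.12 sub-crew, seat abc-iut-c312-7, gen 3; sequel of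
`Cor312PilotIdelesPrArch`); TAKES NO SIDE. At abc-iut-w5-d163's honest-`∞` setting the Θ-boxes at `∞` are their Step (vii) container
`π^{j+1}·B_I` of log-volume `(j+1)·log π` ([IUTchIV] Thm. 1.10 Step (vii) p. 30; their `logvol_thetaRegion3_settingPrVolArch_inl_of_eq`),
while at the primes the sharp boxes of Θ-ideles realising `P_Θ` have the print-normalised volumes of this seat's
`Cor312PilotIdelesPrThetaSide`. THIS file adds the two up:

* `logvol_thetaRegion_settingPrVolArchSharp_inl/_inr`, `finsum_logvol_thetaRegion_settingPrVolArchSharp = −ndeg(P_{Θ,i+1}) + (i+2)·log π`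
  (additivity of the procession average: `Repair.CandDupuyHilado31.processionNormalized_add`, reused);
* **`processionNormalized_thetaRegion_settingPrVolArchSharp`** — for EVERY assignment of lattice positions the procession-normalised global
  volume of the chosen Kummer images is `−ndegLgp X.thetaPilot + processionNormalized (fun i => (i+2)·log π)`;
* **`thetaRegionVolume_le_negLogTheta_settingPrVolArchSharp`** — that number is `≤ −|log(Θ)|` (trivial direction, monotone volumes;
  abc-iut-w5-d163 `logvolMono_settingPrVolArch`);
* **`globalVolumeTransport_settingPrVolArchSharp_iff`** — TEAM B's GAP input G-c312-11-1 at this setting is EQUIVALENT to the explicit inequality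
  `−deĝ(P_q) ≤ −deĝ_lgp(P_Θ) + 𝔼_j (j+1)·log π` between Arakelov degrees of the pilot divisors and the archimedean constant: UNLIKE at the
  trivial-`∞` corner (`not_globalVolumeTransport_settingPrVolSharp`), the honest archimedean container ADDS `(j+1)·log π > 0` on the Θ-side, so the
  input is no longer refuted outright — its truth is the sign of ONE real number computed from `(F, E, l)`; nothing here evaluates that sign.
[claim: Mochizuki2012, status: disputed] for the quoted setting; [cite: Mochizuki2012, IUTchIV Thm 1.10 proof Step (vii) p. 30];
[cite: DupuyHilado2025, §3.3, Thm. 3.10.1]. HONEST FRAMING: the `∞`-boxes are w5-d163's MODEL; numbers at one instantiation; no judgement.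
typed ≠ proved; instantiated ≠ endorsed.
-/

noncomputable section

open Set Function NumberField IsDedekindDomain
open scoped Pointwise

namespace Summit.ABC

namespace IUTFork

namespace Thm311

namespace Real

open Cor312 Cor312Vol Literature.IUT.LogThetaLattice Literature.IUT.LogVolume

variable {F : Type} [Field F] [NumberField F] (X : PilotData F) {logv : PadicLogs F} (hlog : LogvAnalytic logv)
  (hc : ∀ w : InfinitePlace F, w.IsComplex) (M : Type) [Field M] [NumberField M]
  (archPk : ∀ (j : (thetaIndex X).Label) (vQ : (thetaIndex X).VQ), Set ((logShellsDH X logv).Packet j vQ))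
  (archSub : ∀ (j : (thetaIndex X).Label) (v : (thetaIndex X).V),
    Set ((logShellsDH X logv).Packet j ((thetaIndex X).over v)))
  (Ψ : ℤ → ∀ v : (thetaIndex X).V, v ∈ (thetaIndex X).Vbad → Set ((logShellsDH X logv).StarPacket v))
  (act : ℤ → ∀ v : (thetaIndex X).V, v ∈ (thetaIndex X).Vbad →
    (logShellsDH X logv).StarPacket v → Module.End ℚ ((logShellsDH X logv).StarPacket v))
  (Mmod : ℤ → ∀ j : (thetaIndex X).LabelStar, Set ((logShellsDH X logv).GlobalPacket j.1))
  (region : ℤ → ∀ j : (thetaIndex X).LabelStar, FinDivisor M → ∀ vQ : (thetaIndex X).VQ,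
    Set ((logShellsDH X logv).Packet j.1 vQ))
  (n : ℤ) {HT : Type} {LogLink : HT → HT → Type} {IsFull : ∀ {s t : HT}, LogLink s t → Prop}
  (lat : LGPGaussianLogThetaLattice LogLink IsFull)
  {Frd : Type} {IsoF : Frd → Frd → Type} {Ob : Frd → Type} {realify : Frd → Frd} {Strip : Type}
  {IsoS : Strip → Strip → Type} {Mv : ∀ v : (thetaIndex X).V, v ∈ (thetaIndex X).Vbad → Type}
  [∀ v h, Monoid (Mv v h)]
  (sig : GlobalLGPFrobenioidSignature (thetaIndex X).lstar (thetaIndex X).V (· ∈ (thetaIndex X).Vbad)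
    Frd IsoF Ob realify Strip IsoS Mv)
  (split : SplittingMonoids Mv) {ObΔ : Type} {N : ∀ v : (thetaIndex X).V, v ∈ (thetaIndex X).Vbad → Type}
  [∀ v h, Monoid (N v h)] (qData : QPilotData ObΔ N)
  (t : ∀ (pp : Nat.Primes) (_ : Fin X.lstar) (x : (thetaIndex X).Fibre (.inr pp)),
    haveI : Fact (pp : ℕ).Prime := ⟨pp.2⟩; kOf X pp.1 x)
  (tq : ∀ (pp : Nat.Primes) (x : (thetaIndex X).Fibre (.inr pp)), haveI : Fact (pp : ℕ).Prime := ⟨pp.2⟩; kOf X pp.1 x)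
  (ht0 : ∀ pp i x, t pp i x ≠ 0)
  (ht : ∀ (pp : Nat.Primes) (i : Fin X.lstar) (x : (thetaIndex X).Fibre (.inr pp)),
    haveI : Fact (pp : ℕ).Prime := ⟨pp.2⟩
    Real.log ‖t pp i x‖ = -(X.thetaPilot i (placeOf X pp.1 x)) * logNorm F (placeOf X pp.1 x) /
      localDegree F (placeOf X pp.1 x))
  (htq0 : ∀ pp x, tq pp x ≠ 0)
  (htq1 : ∀ (pp : Nat.Primes) (x : (thetaIndex X).Fibre (.inr pp)),
    haveI : Fact (pp : ℕ).Prime := ⟨pp.2⟩; placeOf X pp.1 x ∉ X.S → ‖tq pp x‖ = 1)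

/-- The archimedean Θ-image volume at every label: `(j+1)·log π` (the region IS abc-iut-w5-d163's Step (vii) container).
[cite: Mochizuki2012, IUTchIV Thm 1.10 proof Step (vii) p. 30] -/
theorem logvol_thetaRegion_settingPrVolArchSharp_inl (m : ℤ) (j : (thetaIndex X).Label) :
    ((situationDHVolPrArch X hlog hc M archPk archSub Ψ act Mmod region).D n).logvol j (.inl ())
      ((settingPrVolArchSharp X hlog hc M archPk archSub Ψ act Mmod region n lat sig split qData t tq htq0 htq1).thetaRegion m j
        (.inl ())) =
      Fintype.card ((thetaIndex X).Caps j) * Real.log Real.pi := by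
  have h : (settingPrVolArchSharp X hlog hc M archPk archSub Ψ act Mmod region n lat sig split qData t tq htq0 htq1).thetaRegion m j
      (.inl ()) =
      (settingPrVolArchSharp X hlog hc M archPk archSub Ψ act Mmod region n lat sig split qData t tq htq0 htq1).thetaRegion3 j (.inl ()) := by
    ext x
    simp only [Setting.thetaRegion3, Set.mem_iUnion]
    exact ⟨fun hx => ⟨m, hx⟩, fun ⟨_, hx⟩ => hx⟩
  rw [h]
  exact logvol_thetaRegion3_settingPrVolArch_inl_of_eq X hlog hc M archPk archSub Ψ act Mmod region n lat sig split qData _ _ _ j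
    (Set.iUnion_const _)

include ht0 ht in
/-- At a prime the Θ-image volumes of the fourth corner are the print-normalised ones of `Cor312PilotIdelesPrThetaSide` (same container,
same boxes). [folklore] -/
theorem logvol_thetaRegion_settingPrVolArchSharp_inr (m : ℤ) (i : Fin (thetaIndex X).lstar) (pp : Nat.Primes) :
    ((situationDHVolPrArch X hlog hc M archPk archSub Ψ act Mmod region).D n).logvol (Setting.labelSucc i) (.inr pp)
      ((settingPrVolArchSharp X hlog hc M archPk archSub Ψ act Mmod region n lat sig split qData t tq htq0 htq1).thetaRegion m
        (Setting.labelSucc i) (.inr pp)) =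
      (∑ v ∈ placesOver F pp, -(X.thetaPilot i v) * logNorm F v) / Module.finrank ℚ F :=
  logvol_thetaRegion_sharp_Pr_inr X hlog M archPk archSub Ψ act Mmod region n lat sig split qData t ht0 ht
    (fun _ => qCentreDH X hlog tq) (qCentreDH_ne_zero X hlog tq htq0)
    (finite_support_logvol_qRegion_Pr X hlog M archPk archSub Ψ act Mmod region n tq htq0 htq1) m i pp

include ht0 ht in
/-- **The global volume of every Kummer image at the label `j = i+1` is `−deĝ(P_{Θ,j}) + (j+1)·log π`.**
[cite: DupuyHilado2025, Thm. 3.10.1] [cite: Mochizuki2012, IUTchIV Thm 1.10 proof Step (vii) p. 30] -/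
theorem finsum_logvol_thetaRegion_settingPrVolArchSharp (m : ℤ) (i : Fin (thetaIndex X).lstar) :
    ∑ᶠ vQ : (thetaIndex X).VQ,
        ((situationDHVolPrArch X hlog hc M archPk archSub Ψ act Mmod region).D n).logvol (Setting.labelSucc i) vQ
          ((settingPrVolArchSharp X hlog hc M archPk archSub Ψ act Mmod region n lat sig split qData t tq htq0 htq1).thetaRegion m
            (Setting.labelSucc i) vQ) =
      -FinDivisor.ndeg F (X.thetaPilot i) + Fintype.card ((thetaIndex X).Caps (Setting.labelSucc i)) * Real.log Real.pi := by
  -- split the function into its prime part (= the trivial-`∞` setting's) and the archimedean point mass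
  set f : (thetaIndex X).VQ → ℝ := fun vQ =>
    ((situationPrVol X hlog M archPk archSub Ψ act Mmod region).D n).logvol (Setting.labelSucc i) vQ
      ((settingPrVol X hlog M archPk archSub Ψ act Mmod region n lat sig split qData
        (fun _ _ => thetaBoxDH X hlog (sharpBoxDH X hlog t)) (fun _ => qCentreDH X hlog tq) (qCentreDH_ne_zero X hlog tq htq0)
        (finite_support_logvol_qRegion_Pr X hlog M archPk archSub Ψ act Mmod region n tq htq0 htq1)).thetaRegion m
          (Setting.labelSucc i) vQ) with hf
  set g : (thetaIndex X).VQ → ℝ := fun vQ =>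
    match vQ with
    | .inl _ => Fintype.card ((thetaIndex X).Caps (Setting.labelSucc i)) * Real.log Real.pi
    | .inr _ => 0 with hg
  have hsplit : ∀ vQ, ((situationDHVolPrArch X hlog hc M archPk archSub Ψ act Mmod region).D n).logvol (Setting.labelSucc i) vQ
      ((settingPrVolArchSharp X hlog hc M archPk archSub Ψ act Mmod region n lat sig split qData t tq htq0 htq1).thetaRegion m
        (Setting.labelSucc i) vQ) = f vQ + g vQ := by
    rintro (u | pp)
    · cases u
      rw [logvol_thetaRegion_settingPrVolArchSharp_inl]
      have h0 : f (.inl ()) = 0 := logvol_situationPrVol_inl X hlog M archPk archSub Ψ act Mmod region n () _ _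
      rw [h0, zero_add]
    · show _ = ((situationPrVol X hlog M archPk archSub Ψ act Mmod region).D n).logvol (Setting.labelSucc i) (.inr pp) _ + 0
      rw [add_zero]
      rfl
  have hfsupp : (Function.support f).Finite :=
    finite_support_logvol_thetaRegion_sharp_Pr X hlog M archPk archSub Ψ act Mmod region n lat sig split qData t ht0 ht _ _ _ m i
  have hgsupp : (Function.support g).Finite :=
    (Set.finite_range (Sum.inl : Unit → (thetaIndex X).VQ)).subset (by
      rintro (u | pp) hvQ
      · exact ⟨u, rfl⟩
      · exact absurd rfl hvQ)
  rw [finsum_congr hsplit, finsum_add_distrib hfsupp hgsupp,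
    finsum_logvol_thetaRegion_sharp_Pr X hlog M archPk archSub Ψ act Mmod region n lat sig split qData t ht0 ht _ _ _ m i,
    finsum_eq_single g (.inl ()) (by
      rintro (u | pp) h
      · cases u
        exact absurd rfl h
      · rfl)]

include ht0 ht in
/-- **For EVERY assignment of lattice positions, the procession-normalised global volume of the chosen Kummer images at the fourth corner
is `−deĝ_lgp(P_Θ) + 𝔼_j (j+1)·log π`.** [cite: DupuyHilado2025, Thm. 3.10.1] -/
theorem processionNormalized_thetaRegion_settingPrVolArchSharp (m : Fin (thetaIndex X).lstar → (thetaIndex X).VQ → ℤ) :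
    processionNormalized (fun i : Fin (thetaIndex X).lstar => ∑ᶠ vQ : (thetaIndex X).VQ,
        ((situationDHVolPrArch X hlog hc M archPk archSub Ψ act Mmod region).D n).logvol (Setting.labelSucc i) vQ
          ((settingPrVolArchSharp X hlog hc M archPk archSub Ψ act Mmod region n lat sig split qData t tq htq0 htq1).thetaRegion
            (m i vQ) (Setting.labelSucc i) vQ)) =
      -LgpDivisor.ndegLgp X.thetaPilot +
        processionNormalized (fun i : Fin (thetaIndex X).lstar =>
          (Fintype.card ((thetaIndex X).Caps (Setting.labelSucc i)) : ℝ) * Real.log Real.pi) := by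
  rw [← processionNormalized_neg_ndeg_thetaPilot X, ← Repair.CandDupuyHilado31.processionNormalized_add]
  congr 1
  funext i
  have hpt : ∀ vQ, ((situationDHVolPrArch X hlog hc M archPk archSub Ψ act Mmod region).D n).logvol (Setting.labelSucc i) vQ
        ((settingPrVolArchSharp X hlog hc M archPk archSub Ψ act Mmod region n lat sig split qData t tq htq0 htq1).thetaRegion
          (m i vQ) (Setting.labelSucc i) vQ) =
      ((situationDHVolPrArch X hlog hc M archPk archSub Ψ act Mmod region).D n).logvol (Setting.labelSucc i) vQ
        ((settingPrVolArchSharp X hlog hc M archPk archSub Ψ act Mmod region n lat sig split qData t tq htq0 htq1).thetaRegion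
          0 (Setting.labelSucc i) vQ) := fun _ => rfl
  simp_rw [hpt]
  exact finsum_logvol_thetaRegion_settingPrVolArchSharp X hlog hc M archPk archSub Ψ act Mmod region n lat sig split qData t tq ht0 ht
    htq0 htq1 0 i

include ht0 ht in
/-- **`−deĝ_lgp(P_Θ) + 𝔼_j (j+1)·log π ≤ −|log(Θ)|` at the fourth corner** (trivial direction: the hull contains every image; monotone volumes —
abc-iut-w5-d163 `logvolMono_settingPrVolArch`, abc-iut-c312-6 `logvol_thetaRegion_le_thetaLocal_of_mono`).
[claim: Mochizuki2012, status: disputed] -/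
theorem thetaRegionVolume_le_negLogTheta_settingPrVolArchSharp
    (ht1 : ∀ (pp : Nat.Primes) (i : Fin X.lstar) (x : (thetaIndex X).Fibre (.inr pp)),
      haveI : Fact (pp : ℕ).Prime := ⟨pp.2⟩; placeOf X pp.1 x ∉ X.S → ‖t pp i x‖ = 1) :
    (((-LgpDivisor.ndegLgp X.thetaPilot +
        processionNormalized (fun i : Fin (thetaIndex X).lstar =>
          (Fintype.card ((thetaIndex X).Caps (Setting.labelSucc i)) : ℝ) * Real.log Real.pi) : ℝ)) : WithTop ℝ) ≤
      (settingPrVolArchSharp X hlog hc M archPk archSub Ψ act Mmod region n lat sig split qData t tq htq0 htq1).negLogTheta := by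
  have hfin := thetaFinite_settingPrVolArchSharp X hlog hc M archPk archSub Ψ act Mmod region n lat sig split qData t tq ht0 ht1 htq0 htq1
  have hadm := thetaRegionsAdm_settingPrVolArchSharp X hlog hc M archPk archSub Ψ act Mmod region n lat sig split qData t tq ht0 htq0 htq1
  have hmono := logvolMono_settingPrVolArch X hlog hc M archPk archSub Ψ act Mmod region n lat sig split qData
    (fun _ _ => thetaBoxDHArchSharp X hlog t) (fun _ => qCentreDHArch X hlog tq) (qCentreDHArch_ne_zero X hlog tq htq0)
    (finite_support_logvol_qRegion_PrArch X hlog hc tq M archPk archSub Ψ act Mmod region n htq0 htq1)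
  unfold Setting.negLogTheta
  rw [if_pos hfin, WithTop.coe_le_coe,
    ← processionNormalized_thetaRegion_settingPrVolArchSharp X hlog hc M archPk archSub Ψ act Mmod region n lat sig split qData t tq ht0 ht
      htq0 htq1 (fun _ _ => 0)]
  refine processionNormalized_mono fun i => ?_
  refine finsum_le_finsum' ?_ (hfin.2 i) fun vQ => logvol_thetaRegion_le_thetaLocal_of_mono hmono hfin hadm 0 i vQ
  -- the Θ-image volumes are supported on `{∞} ∪` the primes under the support of `P_{Θ,i+1}`
  refine ((Set.finite_range (Sum.inl : Unit → (thetaIndex X).VQ)).union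
    ((finite_support_logvol_thetaRegion_sharp_Pr X hlog M archPk archSub Ψ act Mmod region n lat sig split qData t ht0 ht
      (fun _ => qCentreDH X hlog tq) (qCentreDH_ne_zero X hlog tq htq0)
      (finite_support_logvol_qRegion_Pr X hlog M archPk archSub Ψ act Mmod region n tq htq0 htq1) 0 i))).subset ?_
  rintro (u | pp) hvQ
  · exact Or.inl ⟨u, rfl⟩
  · exact Or.inr hvQ

include ht0 ht in
/-- **TEAM B's GAP input at the fourth corner is an EXPLICIT numerical inequality**: `GlobalVolumeTransport ↔
−deĝ(P_q) ≤ −deĝ_lgp(P_Θ) + 𝔼_j (j+1)·log π` (for `q`-ideles realising `P_q`; every position family has the same volume, and the constant family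
has finitely supported volumes). At the trivial-`∞` corner the right side lacked the positive archimedean term and the input was FALSE
(`not_globalVolumeTransport_settingPrVolSharp`); here its truth is the sign of one real number of `(F, E, l)`, not evaluated.
[claim: Mochizuki2012, status: disputed] -/
theorem globalVolumeTransport_settingPrVolArchSharp_iff
    (htq : ∀ (pp : Nat.Primes) (x : (thetaIndex X).Fibre (.inr pp)),
      haveI : Fact (pp : ℕ).Prime := ⟨pp.2⟩
      Real.log ‖tq pp x‖ = -(X.qPilot (placeOf X pp.1 x)) * logNorm F (placeOf X pp.1 x) /
        localDegree F (placeOf X pp.1 x)) :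
    GlobalVolumeTransport (settingPrVolArchSharp X hlog hc M archPk archSub Ψ act Mmod region n lat sig split qData t tq htq0 htq1) ↔
      -FinDivisor.ndeg F X.qPilot ≤ -LgpDivisor.ndegLgp X.thetaPilot +
        processionNormalized (fun i : Fin (thetaIndex X).lstar =>
          (Fintype.card ((thetaIndex X).Caps (Setting.labelSucc i)) : ℝ) * Real.log Real.pi) := by
  -- the unfolded `GlobalVolumeTransport` reads the line index as `P.n` (definitionally `n`): restate the volume identity in that form
  have hPN : ∀ m : Fin (thetaIndex X).lstar → (thetaIndex X).VQ → ℤ,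
      processionNormalized (fun i : Fin (thetaIndex X).lstar => ∑ᶠ vQ : (thetaIndex X).VQ,
        ((situationDHVolPrArch X hlog hc M archPk archSub Ψ act Mmod region).D
          (settingPrVolArchSharp X hlog hc M archPk archSub Ψ act Mmod region n lat sig split qData t tq htq0 htq1).n).logvol
          (Setting.labelSucc i) vQ
          ((settingPrVolArchSharp X hlog hc M archPk archSub Ψ act Mmod region n lat sig split qData t tq htq0 htq1).thetaRegion
            (m i vQ) (Setting.labelSucc i) vQ)) =
      -LgpDivisor.ndegLgp X.thetaPilot +
        processionNormalized (fun i : Fin (thetaIndex X).lstar =>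
          (Fintype.card ((thetaIndex X).Caps (Setting.labelSucc i)) : ℝ) * Real.log Real.pi) := fun m =>
    processionNormalized_thetaRegion_settingPrVolArchSharp X hlog hc M archPk archSub Ψ act Mmod region n lat sig split qData t tq ht0 ht
      htq0 htq1 m
  constructor
  · rintro ⟨m, -, hle⟩
    rwa [negLogQ_settingPrVolArchSharp X hlog hc M archPk archSub Ψ act Mmod region n lat sig split qData t tq htq0 htq1 htq, hPN m] at hle
  · intro hle
    refine ⟨fun _ _ => 0, fun i => ?_, ?_⟩
    · refine ((Set.finite_range (Sum.inl : Unit → (thetaIndex X).VQ)).union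
        ((finite_support_logvol_thetaRegion_sharp_Pr X hlog M archPk archSub Ψ act Mmod region n lat sig split qData t ht0 ht
          (fun _ => qCentreDH X hlog tq) (qCentreDH_ne_zero X hlog tq htq0)
          (finite_support_logvol_qRegion_Pr X hlog M archPk archSub Ψ act Mmod region n tq htq0 htq1) 0 i))).subset ?_
      rintro (u | pp) hvQ
      · exact Or.inl ⟨u, rfl⟩
      · exact Or.inr hvQ
    · rwa [negLogQ_settingPrVolArchSharp X hlog hc M archPk archSub Ψ act Mmod region n lat sig split qData t tq htq0 htq1 htq, hPN]

end Real

end Thm311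

end IUTFork

end Summit.ABC

end
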